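import Literature.Computability.Complexity.GateEliminationCascade

/-!
# Gate elimination, XIII: Case 1 of the proof of Li–Yang's Theorem 4.1

First case of the one-step claim `LiYang2022_step` (Li–Yang, STOC 2022; full version
ECCC TR21-023, §4.1, Case 1: "There is a protected variable feeding two gates or an ∧-type gate.
We substitute an appropriate constant to it, so that a quadratic equation and a free variable is
killed, while eliminating at least two gates via Rule 2 and Rule 3. This will decrease the measure
by `Δμ ≥ 2 - 2α_φ + α_I + α_Q ≥ δ`"), assembled from the toolkit (`GateEliminationSubst`:
`substConst`, `assignProtected`; `GateEliminationCascade`: `elimDataConstFed`, `cascade`).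
Everything is PROVED.

* `StepBranch2 C f R αφ αI αQ 𝒫` — the second disjunct of `LiYang2022_step` for the state
  `(C, 𝒫, R)`, verbatim.
* `stepBranch2_of_protected_two_elims` — the accounting: a constant substitution to a protected
  variable (`Δi ≥ 1`, `Δq = 1`, `ΔΦ ≤ 0`) followed by two eliminations (`2(1 - α_φ)`) gives
  `Δμ ≥ α_I + α_Q + 2 - 2α_φ ≥ δ` (`liYangDelta_le_case1`), with `t = 1`.
* `case1_two_readers` — `x_j` protected and read by two distinct gates.
* `case1_and_gate` — `x_j` protected and read by an ∧-type gate `G` that has a reader (in a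
  normalized circuit `G`, not being the output once trivialized, is not a `0`-gate): the
  constant trivializing `G` is substituted, `G` is eliminated and its readers become fed by a
  constant (`ElimData.trivReaders`), a second elimination follows.

## References

* J. Li, T. Yang, *3.1n − o(n) circuit lower bounds for explicit functions*, STOC 2022
  [LiYang2022]; full version ECCC TR21-023, §4.1 (Case 1), Thm. 4.1.
-/

namespace Literature.Computability.Complexity

open Finset

/-- `δ ≤ α_I + (2 - 2α_φ + α_Q)` (one of the terms of the minimum). [cite: LiYang2022, Thm. 4.1] -/
theorem liYangDelta_le_case1 (αφ αI αQ : ℝ) : liYangDelta αφ αI αQ ≤ αI + (2 - 2 * αφ + αQ) := by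
  unfold liYangDelta
  have : min (αI / 3) (min (2 - 2 * αφ + αQ) (min (4 - 4 * αφ) (min (3 + αφ) (min (5 - αQ)
      ((5 - 2 * αφ + αQ) / 2))))) ≤ 2 - 2 * αφ + αQ := min_le_of_right_le (min_le_left _ _)
  linarith

/-- An ∧-type function is not ⊕-type. [folklore] -/
theorem IsAndOp.not_isXorOp {op : Bool → Bool → Bool} (h : IsAndOp op) : ¬ IsXorOp op := by
  rintro ⟨c, hc⟩
  obtain ⟨c₁, c₂, c₃, ha⟩ := h
  have h00 := (ha false false).symm.trans (hc false false)
  have h01 := (ha false true).symm.trans (hc false true)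
  have h10 := (ha true false).symm.trans (hc true false)
  have h11 := (ha true true).symm.trans (hc true true)
  revert h00 h01 h10 h11
  cases c₁ <;> cases c₂ <;> cases c₃ <;> cases c <;> simp

namespace Semicircuit

variable {n : ℕ}

/-- The second branch of the one-step claim `LiYang2022_step`, as a predicate on the state
`(C, 𝒫, R)`: `1 ≤ t ≤ 3` substitutions with decrement `≥ δ t`. [cite: LiYang2022, proof of Thm. 4.1 (§4.1)] -/
def StepBranch2 (C : Semicircuit n) (f : (Fin n → ZMod 2) → Bool) (R : RdqSource n) (αφ αI αQ : ℝ)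
    (P : Finset (Fin C.m × Fin C.m)) : Prop :=
  ∃ t : ℕ, 1 ≤ t ∧ t ≤ 3 ∧
    ∃ (C' : Semicircuit n) (R' : RdqSource n) (P' : Finset (Fin C'.m × Fin C'.m)),
      C'.Fair ∧ C'.ComputesRestr f R' ∧ C'.IsPacking P' ∧ R'.dim + t = R.dim ∧
        liYangDelta αφ αI αQ * t ≤ C.measure αφ αI αQ P R - C'.measure αφ αI αQ P' R'

/-- An ∧-type gate lies in the acyclic part. [cite: LiYang2022, Def. 2.5] -/
theorem not_mem_xorPart_of_isAndOp (C : Semicircuit n) {G : Fin C.m} (h : IsAndOp (C.op G)) : G ∉ C.xorPart :=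
  fun hG => h.not_isXorOp (C.isXorOp_of_mem G hG)

section Case1

variable {C : Semicircuit n} {f : (Fin n → ZMod 2) → Bool} {R : RdqSource n} {d : ℕ}
  {αφ αI αQ : ℝ} {P : Finset (Fin C.m × Fin C.m)}

/-- **The accounting of a constant substitution to a protected variable followed by two
eliminations**: `Δμ ≥ α_I + α_Q + 2(1 - α_φ) ≥ δ` (Li–Yang Case 1: "a quadratic equation and a
free variable is killed, while eliminating at least two gates via Rule 2 and Rule 3. This will
decrease the measure by `Δμ ≥ 2 - 2α_φ + α_I + α_Q ≥ δ`"). [cite: LiYang2022, §4.1 (Case 1)] -/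
theorem stepBranch2_of_protected_two_elims (hφ : 0 ≤ αφ) (hI : 0 ≤ αI)
    {j l : Fin n} {e : QuadEq n} (he : R.quad l = some e) (hr : e.Reads j) (c : ZMod 2)
    (hP : C.IsPacking P)
    {D' : Semicircuit n} {P' : Finset (Fin D'.m × Fin D'.m)} (hF' : D'.Fair)
    (hC' : D'.ComputesRestr f (RdqSource.assignProtected he hr c)) (hP' : D'.IsPacking P')
    (hμ' : D'.measure αφ αI αQ P' (RdqSource.assignProtected he hr c) ≤
      (C.substConst j (finTwoEquiv c)).measure αφ αI αQ (C.substConstPacking j (finTwoEquiv c) P)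
        (RdqSource.assignProtected he hr c) - 2 * (1 - αφ)) :
    C.StepBranch2 f R αφ αI αQ P := by
  have hsub := measure_substConst_le hφ αI αQ hP R (RdqSource.assignProtected he hr c) j (finTwoEquiv c)
  -- `j` was influential (protected) and is no longer counted; one quadratic equation is killed
  have hjinf : j ∈ C.influential R := by
    classical
    unfold influential
    rw [mem_filter]
    exact ⟨mem_univ _, Or.inr (RdqSource.protected_of_reads he hr)⟩
  have hinf : (((C.substConst j (finTwoEquiv c)).influential (RdqSource.assignProtected he hr c)).card : ℝ) + 1 ≤
      (C.influential R).card := by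
    have h1 := card_le_card (C.influential_substConst_assignProtected_subset he hr c (finTwoEquiv c))
    have h2 : (((C.influential R).erase j).filter fun i => e.Reads i → 1 ≤ C.fanout (.var i)).card ≤
        ((C.influential R).erase j).card := card_filter_le _ _
    have h3 := card_erase_of_mem hjinf
    have h4 := card_pos.mpr ⟨j, hjinf⟩
    have : ((C.substConst j (finTwoEquiv c)).influential (RdqSource.assignProtected he hr c)).card + 1 ≤
        (C.influential R).card := by omega
    exact_mod_cast this
  have hq : ((R.quadCount : ℝ)) - (RdqSource.assignProtected he hr c).quadCount = 1 := by
    have := RdqSource.quadCount_assignProtected he hr c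
    have h : ((RdqSource.assignProtected he hr c).quadCount : ℝ) + 1 = R.quadCount := by exact_mod_cast this
    linarith
  refine ⟨1, le_rfl, by norm_num, D', RdqSource.assignProtected he hr c, P', hF', hC', hP',
    RdqSource.dim_assignProtected he hr c, ?_⟩
  have hδ := liYangDelta_le_case1 αφ αI αQ
  simp only [Nat.cast_one, mul_one]
  rw [hq, mul_one] at hsub
  have h1 : αI ≤ αI * (((C.influential R).card : ℝ) -
      ((C.substConst j (finTwoEquiv c)).influential (RdqSource.assignProtected he hr c)).card) := by
    have h2 : (1 : ℝ) ≤ ((C.influential R).card : ℝ) -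
        ((C.substConst j (finTwoEquiv c)).influential (RdqSource.assignProtected he hr c)).card := by linarith
    have := mul_le_mul_of_nonneg_left h2 hI
    rwa [mul_one] at this
  linarith

/-- **Case 1 of Li–Yang's proof of Theorem 4.1, first half**: a protected variable `x_j` read
by two distinct gates. Substituting a constant to `x_j` kills a quadratic equation and a free
variable and makes both readers fed by a constant; two eliminations follow (`cascade`), so
`Δμ ≥ 2 - 2α_φ + α_I + α_Q ≥ δ` with `t = 1` substitution. [cite: LiYang2022, §4.1 (Case 1)] -/
theorem case1_two_readers (hf : IsAffineDisperser f d) (hd : 2 * d + 2 < R.dim) (hF : C.Fair)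
    (hC : C.ComputesRestr f R) (hP : C.IsPacking P) (hφ : 0 ≤ αφ) (hI : 0 ≤ αI) (αQ : ℝ)
    {j l : Fin n} {e : QuadEq n} (he : R.quad l = some e) (hr : e.Reads j)
    {k₁ k₂ : Fin C.m} (hk : k₁ ≠ k₂) (h₁ : ∃ a, C.arg k₁ a = .var j) (h₂ : ∃ a, C.arg k₂ a = .var j) :
    C.StepBranch2 f R αφ αI αQ P := by
  classical
  let c : ZMod 2 := 0
  let C₁ := C.substConst j (finTwoEquiv c)
  have hF₁ : C₁.Fair := hF.substConst j _
  have hC₁' : C₁.ComputesRestr f (RdqSource.assignProtected he hr c) := hC.substConst_assignProtected he hr c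
  have hP₁ : C₁.IsPacking (C.substConstPacking j (finTwoEquiv c) P) := hP.substConst
  have hd' : 2 * d + 2 ≤ (RdqSource.assignProtected he hr c).dim := by
    have := RdqSource.dim_assignProtected he hr c; omega
  -- both readers are fed by a constant in `C₁`
  have hcount : 2 ≤ C₁.constFedCount := by
    unfold constFedCount
    have hmem : ∀ {k : Fin C.m}, (∃ a, C.arg k a = .var j) →
        k ∈ univ.filter fun k => ∃ a b', C₁.arg k a = .const b' := by
      rintro k ⟨a, ha⟩
      refine mem_filter.mpr ⟨mem_univ _, a, finTwoEquiv c, ?_⟩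
      show (C.arg k a).substConst j (finTwoEquiv c) = .const (finTwoEquiv c)
      rw [ha, Node.substConst_var_self]
    have : ({k₁, k₂} : Finset (Fin C.m)) ⊆ univ.filter fun k => ∃ a b', C₁.arg k a = .const b' := by
      intro k hk
      rw [mem_insert, mem_singleton] at hk
      rcases hk with rfl | rfl
      · exact hmem h₁
      · exact hmem h₂
    have h := card_le_card this
    rw [card_pair hk] at h
    exact h
  obtain ⟨D', P', hF', hCD', hP', -, hμ'⟩ := cascade hf hd' hφ hI αQ 2 C₁ _ hF₁ hC₁' hP₁ hcount
  refine stepBranch2_of_protected_two_elims hφ hI he hr c hP hF' hCD' hP' ?_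
  push_cast at hμ'
  linarith

/-- **Case 1 of Li–Yang's proof of Theorem 4.1, second half**: a protected variable `x_j` read
by an ∧-type gate `G` that has a reader (in a normalized circuit: `G` is not a `0`-gate, being
not the output once trivialized). Substituting the constant trivializing `G` kills a quadratic
equation and a free variable; `G` is eliminated and its readers become fed by a constant, so a
second elimination follows: `Δμ ≥ 2 - 2α_φ + α_I + α_Q ≥ δ`, `t = 1`. [cite: LiYang2022, §4.1 (Case 1)] -/
theorem case1_and_gate (hf : IsAffineDisperser f d) (hd : 2 * d + 2 < R.dim) (hF : C.Fair)
    (hC : C.ComputesRestr f R) (hP : C.IsPacking P) (hφ : 0 ≤ αφ) (hI : 0 ≤ αI) (αQ : ℝ)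
    {j l : Fin n} {e : QuadEq n} (he : R.quad l = some e) (hr : e.Reads j)
    {G : Fin C.m} {a : Fin 2} (hGj : C.arg G a = .var j) (hand : IsAndOp (C.op G))
    (hGread : ∃ Q a', C.arg Q a' = .gate G) :
    C.StepBranch2 f R αφ αI αQ P := by
  classical
  obtain ⟨c₁, c₂, c₃, hop⟩ := hand
  -- the constant trivializing `G` at position `a`
  let bG : Bool := if a = 0 then c₁ else c₂
  have hbG : bG = if a = 0 then c₁ else c₂ := rfl
  let c : ZMod 2 := finTwoEquiv.symm bG
  have hb : finTwoEquiv c = bG := finTwoEquiv.apply_symm_apply bG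
  let C₁ := C.substConst j (finTwoEquiv c)
  have hF₁ : C₁.Fair := hF.substConst j _
  have hC₁' : C₁.ComputesRestr f (RdqSource.assignProtected he hr c) := hC.substConst_assignProtected he hr c
  have hP₁ : C₁.IsPacking (C.substConstPacking j (finTwoEquiv c) P) := hP.substConst
  have hd' : 2 * d + 2 ≤ (RdqSource.assignProtected he hr c).dim := by
    have := RdqSource.dim_assignProtected he hr c; omega
  -- `G` is fed by the constant `bG` at position `a`, and trivialized
  have h₀ : C₁.arg G a = .const bG := by
    show (C.arg G a).substConst j (finTwoEquiv c) = .const bG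
    rw [hGj, Node.substConst_var_self, hb]
  have htriv : C₁.liveFn G a bG false = C₁.liveFn G a bG true := by
    show C.liveFn G a bG false = C.liveFn G a bG true
    unfold liveFn
    obtain rfl | rfl : a = 0 ∨ a = 1 := by fin_cases a <;> simp
    · rw [if_pos rfl, if_pos rfl, hop, hop, hbG, if_pos rfl]
      cases c₁ <;> cases c₂ <;> cases c₃ <;> rfl
    · rw [if_neg (by decide), if_neg (by decide), hop, hop, hbG, if_neg (by decide)]
      cases c₁ <;> cases c₂ <;> cases c₃ <;> rfl
  have hself : ∀ a', C₁.arg G a' ≠ .gate G := hF₁.not_reads_self_of_const h₀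
  -- eliminate `G`; its readers become fed by a constant
  let E := elimDataConstFed (C := C₁) (k₀ := G) hf hd' hF₁ hC₁' hP₁ h₀ hself hφ hI αQ
  have hcount : 1 ≤ E.C'.constFedCount := by
    refine le_trans ?_ (E.constFedCount_le_of_triv ⟨a, bG, h₀, htriv⟩)
    obtain ⟨Q, a', hQ⟩ := hGread
    have hQG : Q ≠ G := by
      rintro rfl
      exact C.arg_ne_self_of_not_mem (C.not_mem_xorPart_of_isAndOp ⟨c₁, c₂, c₃, hop⟩) a' hQ
    refine card_pos.mpr ⟨Q, mem_filter.mpr ⟨mem_univ _, hQG, Or.inr ⟨a', ?_⟩⟩⟩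
    show (C.arg Q a').substConst j (finTwoEquiv c) = .gate G
    rw [hQ]; rfl
  obtain ⟨D', P', hF', hCD', hP', -, hμ'⟩ := cascade hf hd' hφ hI αQ 1 E.C' E.P' E.fair E.computes E.packing hcount
  refine stepBranch2_of_protected_two_elims hφ hI he hr c hP hF' hCD' hP' ?_
  have := E.measure_le
  push_cast at hμ'
  linarith

end Case1

end Semicircuit

end Literature.Computability.Complexity
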